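import Literature.Computability.Complexity.SparseSetsUpwardSeparationCodes
import Literature.Computability.Complexity.KarpLipton
import HarnessLib

/-!
# Upward separation, the census language: `S'` read on unary tuples is in `NP`

Topic `Literature/Computability/Complexity`, third proof file of the named fact
`hartmanisImmermanSewelson1985_thm1` (`SparseSetsUpwardSeparation.lean`), continuing
`SparseSetsUpwardSeparationCodes.lean` (chains, `UpSep.Cens`, the tuples `ucode`/`code`). Items 2–3 of
the proof of Thm. 1 of Hartmanis–Immerman–Sewelson 1985 (Information and Control 65, p. 164):

> "2. Given a five-tuple `n#i#j#k#d` we need to guess only a polynomial in `n` number of strings of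
> length `n` to verify that `n#i#j#k#d ∈ S'`. 3. Verification of membership in `S` is a
> nondeterministic polynomial-in-`n` process — so requires an existential quantifier."

Here, on UNARY tuples `v = ucode n i j k d` (so that "polynomial in `n`" is polynomial in `|v|`):

* `UpSep.padLang S = JLt ⊓ {v | ∃ Y, |Y| ≤ |v|² ∧ ⟨v, Y⟩ ∈ witnessLang S}` — guess the list `Y`
  (a `body` code of the chain), check `j < i`, the digit condition, and for every `m < |⟨v, Y⟩|`:
  out of range (`m ≥ i`), or the `m`-th listed word has length `n`, is below the next one in value,
  and is IN `S` — the last an `NP` condition; PROVED to be in `NP` for `S ∈ NP` by the tree's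
  closure lemmas alone (`NPBounded.ballLang_mem_NP`, `preimage_mem_NP`, unions/intersections with
  `P` languages, `KarpLipton.polyExists_polyExists_subset`; tests `LenLe/LenLt/LenEq`, `Brick.ltFn`,
  `bitAtFn`, list access `PRelSigPi.elemFn`) — **`UpSep.padLang_mem_NP`**;
* **`UpSep.ucode_mem_padLang_iff`**: `ucode n i j k d ∈ padLang S ↔ Cens S n i j k d`.

The binary-named census language is `decodeFn⁻¹(padLang S)`, placed in `NE` (and under `E = NE` in
`E`) by `preimage_mem_NE_of_mem_FE` (`SparseSetsUpwardSeparationNE.lean`). No named fact is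
introduced (D-0026); all `def`s are proof devices in the namespace `UpSep`.

## References

* J. Hartmanis, N. Immerman, V. Sewelson, *Sparse sets in NP−P: EXPTIME versus NEXPTIME*,
  Information and Control 65 (1985) 158–181, Thm. 1, pp. 163–164 (held:
  `paper:doi-10-1016-s0019-9958-85-80004-8`, PDF pp. 6–7). [HartmanisImmermanSewelson1985]
* S. Arora, B. Barak, *Computational Complexity: A Modern Approach*, CUP 2009, Def. 2.1, §1.3
  (polynomially bounded loops), Exercise 2.10. [AroraBarakCC2009]
-/

noncomputable section

namespace Literature.Computability.Complexity

open _root_.Computability Polynomial OracleCompose PRelSigPi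

namespace UpSep

/-! ### The census language on unary tuples is in `NP` (closure lemmas only) -/

/-- `(l ↓ k) ↾ 1 = [d]` reads the `k`-th symbol. [folklore] -/
theorem getD_eq_of_take_drop {l : List Bool} {k : ℕ} {d : Bool} (h : (l.drop k).take 1 = [d]) :
    l.getD k false = d := by
  rcases lt_or_ge k l.length with hk | hk
  · rw [List.take_one_drop_eq_of_lt_length hk] at h
    rw [List.getD_eq_getElem _ _ hk]
    simpa using h
  · rw [List.drop_eq_nil_of_le hk] at h
    simp at h

section PadLang

variable (S : Language Bool)

/-! Words of the inner loop are `z = ⟨⟨v, Y⟩, 1ᵐ⟩`: the tuple `v`, the guessed list `Y` (a `body`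
code of the chain), the loop index `m`. -/

/-- The `m`-th listed word, `elemOf Y m`, read off `⟨⟨v, Y⟩, 1ᵐ⟩`. [folklore] -/
def itemFn : List Bool → List Bool := elemFn ∘ pairFn sndP (sndP ∘ fstP)

/-- The `(m+1)`-th listed word, read off `⟨⟨v, Y⟩, 1ᵐ⟩`. [folklore] -/
def nextFn : List Bool → List Bool := elemFn ∘ pairFn (List.cons true ∘ sndP) (sndP ∘ fstP)

/-- `itemFn ∈ FP`. [folklore] -/
theorem itemFn_mem_FP : itemFn ∈ FP :=
  comp_mem_FP elemFn_mem_FP (pairFn_mem_FP sndP_mem_FP (comp_mem_FP sndP_mem_FP fstP_mem_FP))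

/-- `nextFn ∈ FP`. [folklore] -/
theorem nextFn_mem_FP : nextFn ∈ FP :=
  comp_mem_FP elemFn_mem_FP (pairFn_mem_FP (comp_mem_FP (cons_mem_FP true) sndP_mem_FP)
    (comp_mem_FP sndP_mem_FP fstP_mem_FP))

/-- Value of `itemFn`. [folklore] -/
@[simp] theorem itemFn_apply (v Y u : List Bool) :
    itemFn (boolPair (boolPair v Y) u) = elemOf Y u.length := by
  simp [itemFn, elemFn_boolPair]

/-- Value of `nextFn`. [folklore] -/
@[simp] theorem nextFn_apply (v Y u : List Bool) :
    nextFn (boolPair (boolPair v Y) u) = elemOf Y (u.length + 1) := by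
  simp [nextFn, elemFn_boolPair]

/-- "Index out of range": `i ≤ m` (`i = |field 1 of v|`). [folklore] -/
def OutOfRange : Language Bool := pairFn sndP (Brick.nthF 1 ∘ fstP ∘ fstP) ⁻¹' LenLe X

/-- "Next index out of range": `i ≤ m + 1`. [folklore] -/
def NextOutOfRange : Language Bool :=
  pairFn (List.cons true ∘ sndP) (Brick.nthF 1 ∘ fstP ∘ fstP) ⁻¹' LenLe X

/-- `OutOfRange ∈ P`. [folklore] -/
theorem OutOfRange_mem_P : OutOfRange ∈ Classes.P :=
  preimage_mem_P (LenLe_mem_P X) (pairFn_mem_FP sndP_mem_FP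
    (comp_mem_FP (Brick.nthF_mem_FP 1) (comp_mem_FP fstP_mem_FP fstP_mem_FP)))

/-- `NextOutOfRange ∈ P`. [folklore] -/
theorem NextOutOfRange_mem_P : NextOutOfRange ∈ Classes.P :=
  preimage_mem_P (LenLe_mem_P X) (pairFn_mem_FP (comp_mem_FP (cons_mem_FP true) sndP_mem_FP)
    (comp_mem_FP (Brick.nthF_mem_FP 1) (comp_mem_FP fstP_mem_FP fstP_mem_FP)))

/-- Membership in `OutOfRange`. [folklore] -/
theorem mem_OutOfRange_iff (v Y u : List Bool) :
    boolPair (boolPair v Y) u ∈ OutOfRange ↔ (Brick.nthF 1 v).length ≤ u.length := by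
  change pairFn sndP (Brick.nthF 1 ∘ fstP ∘ fstP) (boolPair (boolPair v Y) u) ∈ LenLe X ↔ _
  simp

/-- Membership in `NextOutOfRange`. [folklore] -/
theorem mem_NextOutOfRange_iff (v Y u : List Bool) :
    boolPair (boolPair v Y) u ∈ NextOutOfRange ↔ (Brick.nthF 1 v).length ≤ u.length + 1 := by
  change pairFn (List.cons true ∘ sndP) (Brick.nthF 1 ∘ fstP ∘ fstP) (boolPair (boolPair v Y) u) ∈ LenLe X ↔ _
  simp

/-- "The `m`-th listed word has length `n`" (`n = |field 0 of v|`). [folklore] -/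
def ItemLen : Language Bool := pairFn (Brick.nthF 0 ∘ fstP ∘ fstP) itemFn ⁻¹' LenEq X

/-- `ItemLen ∈ P`. [folklore] -/
theorem ItemLen_mem_P : ItemLen ∈ Classes.P :=
  preimage_mem_P (LenEq_mem_P X) (pairFn_mem_FP
    (comp_mem_FP (Brick.nthF_mem_FP 0) (comp_mem_FP fstP_mem_FP fstP_mem_FP)) itemFn_mem_FP)

/-- Membership in `ItemLen`. [folklore] -/
theorem mem_ItemLen_iff (v Y u : List Bool) :
    boolPair (boolPair v Y) u ∈ ItemLen ↔ (elemOf Y u.length).length = (Brick.nthF 0 v).length := by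
  change pairFn (Brick.nthF 0 ∘ fstP ∘ fstP) itemFn (boolPair (boolPair v Y) u) ∈ LenEq X ↔ _
  simp

/-- Value comparison as a language: `{w | ltFn w = [1]}` (`⟨a, b⟩ ↦ ⟦a⟧ < ⟦b⟧`). [folklore] -/
def LtVal : Language Bool := {w | Brick.ltFn w = [true]}

/-- `LtVal ∈ P` (`Brick.ltFn ∈ FP` is its indicator). [folklore] -/
theorem LtVal_mem_P : LtVal ∈ Classes.P :=
  mem_P_of_mem_FP Brick.ltFn_mem_FP _ fun w =>
    ⟨fun h => h, fun h => by
      have h' : ¬ Brick.ltFn w = [true] := h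
      unfold Brick.ltFn at h' ⊢
      simpa using h'⟩

/-- Membership of a pair in `LtVal`. [folklore] -/
@[simp] theorem boolPair_mem_LtVal (a b : List Bool) : boolPair a b ∈ LtVal ↔ bitsToNat a < bitsToNat b := by
  change Brick.ltFn (boolPair a b) = [true] ↔ _
  simp

/-- "The `m`-th listed word is below the `(m+1)`-th in value." [folklore] -/
def ItemLt : Language Bool := pairFn itemFn nextFn ⁻¹' LtVal

/-- `ItemLt ∈ P`. [folklore] -/
theorem ItemLt_mem_P : ItemLt ∈ Classes.P :=
  preimage_mem_P LtVal_mem_P (pairFn_mem_FP itemFn_mem_FP nextFn_mem_FP)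

/-- Membership in `ItemLt`. [folklore] -/
theorem mem_ItemLt_iff (v Y u : List Bool) :
    boolPair (boolPair v Y) u ∈ ItemLt ↔
      bitsToNat (elemOf Y u.length) < bitsToNat (elemOf Y (u.length + 1)) := by
  change pairFn itemFn nextFn (boolPair (boolPair v Y) u) ∈ LtVal ↔ _
  simp

/-- "The `m`-th listed word is in `S`" — an `NP` condition for `S ∈ NP` (item 3 of p. 164:
"verification of membership in `S` is a nondeterministic polynomial-in-`n` process").
[cite: HartmanisImmermanSewelson1985, Theorem 1 (proof, p. 164)] -/
def ItemMem : Language Bool := itemFn ⁻¹' S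

/-- Membership in `ItemMem`. [folklore] -/
theorem mem_ItemMem_iff (v Y u : List Bool) :
    boolPair (boolPair v Y) u ∈ ItemMem S ↔ elemOf Y u.length ∈ S := by
  change itemFn (boolPair (boolPair v Y) u) ∈ S ↔ _
  rw [itemFn_apply]

/-- The matrix of the inner loop: out of range, or the `m`-th word has length `n`, is below the
next one (if that is in range) and is in `S`. [folklore] -/
def ballMatrix : Language Bool :=
  (OutOfRange ⊔ ItemLen) ⊓ ((NextOutOfRange ⊔ ItemLt) ⊓ (OutOfRange ⊔ ItemMem S))

variable {S}

/-- `ballMatrix S ∈ NP` for `S ∈ NP`. [folklore] -/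
theorem ballMatrix_mem_NP (hS : S ∈ Nondeterministic.NP) : ballMatrix S ∈ Nondeterministic.NP :=
  inter_P_mem_polyExists (fun _ _ h₁ h₂ => inter_mem_P h₁ h₂) (union_mem_P OutOfRange_mem_P ItemLen_mem_P)
    (inter_P_mem_polyExists (fun _ _ h₁ h₂ => inter_mem_P h₁ h₂)
      (union_mem_P NextOutOfRange_mem_P ItemLt_mem_P)
      (union_P_mem_polyExists (fun _ _ h₁ h₂ => union_mem_P h₁ h₂) OutOfRange_mem_P
        (preimage_mem_NP hS itemFn_mem_FP)))

/-- Membership in the matrix. [folklore] -/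
theorem mem_ballMatrix_iff (v Y u : List Bool) :
    boolPair (boolPair v Y) u ∈ ballMatrix S ↔
      ((Brick.nthF 1 v).length ≤ u.length ∨ (elemOf Y u.length).length = (Brick.nthF 0 v).length) ∧
      ((Brick.nthF 1 v).length ≤ u.length + 1 ∨
          bitsToNat (elemOf Y u.length) < bitsToNat (elemOf Y (u.length + 1))) ∧
      ((Brick.nthF 1 v).length ≤ u.length ∨ elemOf Y u.length ∈ S) := by
  change (_ ∈ OutOfRange ∨ _ ∈ ItemLen) ∧ ((_ ∈ NextOutOfRange ∨ _ ∈ ItemLt) ∧ (_ ∈ OutOfRange ∨ _ ∈ ItemMem S)) ↔ _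
  rw [mem_OutOfRange_iff, mem_ItemLen_iff, mem_NextOutOfRange_iff, mem_ItemLt_iff, mem_ItemMem_iff]

variable (S)

/-! Words of the witness language are `⟨v, Y⟩`. -/

/-- "Digit position out of range": `n ≤ k`. [folklore] -/
def DigitOutOfRange : Language Bool := pairFn (Brick.nthF 3 ∘ fstP) (Brick.nthF 0 ∘ fstP) ⁻¹' LenLe X

/-- `DigitOutOfRange ∈ P`. [folklore] -/
theorem DigitOutOfRange_mem_P : DigitOutOfRange ∈ Classes.P :=
  preimage_mem_P (LenLe_mem_P X) (pairFn_mem_FP (comp_mem_FP (Brick.nthF_mem_FP 3) fstP_mem_FP)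
    (comp_mem_FP (Brick.nthF_mem_FP 0) fstP_mem_FP))

/-- Membership in `DigitOutOfRange`. [folklore] -/
theorem mem_DigitOutOfRange_iff (v Y : List Bool) :
    boolPair v Y ∈ DigitOutOfRange ↔ (Brick.nthF 0 v).length ≤ (Brick.nthF 3 v).length := by
  change pairFn (Brick.nthF 3 ∘ fstP) (Brick.nthF 0 ∘ fstP) (boolPair v Y) ∈ LenLe X ↔ _
  simp

/-- The digit read by the verifier: `bitAtFn ⟨1ᵏ, elemOf Y j⟩`. [folklore] -/
def digitOfItemFn : List Bool → List Bool :=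
  bitAtFn ∘ pairFn (Brick.nthF 3 ∘ fstP) (elemFn ∘ pairFn (Brick.nthF 2 ∘ fstP) sndP)

/-- `digitOfItemFn ∈ FP`. [folklore] -/
theorem digitOfItemFn_mem_FP : digitOfItemFn ∈ FP :=
  comp_mem_FP bitAtFn_mem_FP (pairFn_mem_FP (comp_mem_FP (Brick.nthF_mem_FP 3) fstP_mem_FP)
    (comp_mem_FP elemFn_mem_FP (pairFn_mem_FP (comp_mem_FP (Brick.nthF_mem_FP 2) fstP_mem_FP) sndP_mem_FP)))

/-- Value of `digitOfItemFn`. [folklore] -/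
theorem digitOfItemFn_apply (v Y : List Bool) :
    digitOfItemFn (boolPair v Y) =
      ((elemOf Y (Brick.nthF 2 v).length).drop (Brick.nthF 3 v).length).take 1 := by
  simp [digitOfItemFn, elemFn_boolPair]

/-- "The `k`-th digit of the `j`-th listed word is `d`" (`[d]` = the last field of `v`). [folklore] -/
def DigitEq : Language Bool := {w | digitOfItemFn w = (Brick.sndPow 3 ∘ fstP) w}

/-- `DigitEq ∈ P` (equality test of two `FP` maps). [folklore] -/
theorem DigitEq_mem_P : DigitEq ∈ Classes.P :=
  setOf_apply_eq_apply_mem_P digitOfItemFn_mem_FP (comp_mem_FP (Brick.sndPow_mem_FP 3) fstP_mem_FP)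

/-- Membership in `DigitEq`. [folklore] -/
theorem mem_DigitEq_iff (v Y : List Bool) :
    boolPair v Y ∈ DigitEq ↔
      ((elemOf Y (Brick.nthF 2 v).length).drop (Brick.nthF 3 v).length).take 1 = Brick.sndPow 3 v := by
  change digitOfItemFn (boolPair v Y) = Brick.sndPow 3 (fstP (boolPair v Y)) ↔ _
  rw [digitOfItemFn_apply, fstP_boolPair]

/-- **The witness language** `W`: `⟨v, Y⟩ ∈ W` iff the digit condition holds and, for every
`m < |⟨v, Y⟩|`, the matrix holds at `⟨⟨v, Y⟩, 1ᵐ⟩` (items 2–3 of p. 164: polynomially many words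
of length `n`, each verified). [cite: HartmanisImmermanSewelson1985, Theorem 1 (proof, p. 164)] -/
def witnessLang : Language Bool := (DigitOutOfRange ⊔ DigitEq) ⊓ ballLang X (ballMatrix S)

variable {S}

/-- `witnessLang S ∈ NP` for `S ∈ NP` (`ballLang_mem_NP`). [folklore] -/
theorem witnessLang_mem_NP (hS : S ∈ Nondeterministic.NP) : witnessLang S ∈ Nondeterministic.NP :=
  inter_P_mem_polyExists (fun _ _ h₁ h₂ => inter_mem_P h₁ h₂)
    (union_mem_P DigitOutOfRange_mem_P DigitEq_mem_P) (NPBounded.ballLang_mem_NP X (ballMatrix_mem_NP hS))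

/-- Membership in the witness language. [folklore] -/
theorem mem_witnessLang_iff (v Y : List Bool) :
    boolPair v Y ∈ witnessLang S ↔
      ((Brick.nthF 0 v).length ≤ (Brick.nthF 3 v).length ∨
        ((elemOf Y (Brick.nthF 2 v).length).drop (Brick.nthF 3 v).length).take 1 = Brick.sndPow 3 v) ∧
      ∀ m < 2 * v.length + 2 + Y.length,
        ((Brick.nthF 1 v).length ≤ m ∨ (elemOf Y m).length = (Brick.nthF 0 v).length) ∧
        ((Brick.nthF 1 v).length ≤ m + 1 ∨ bitsToNat (elemOf Y m) < bitsToNat (elemOf Y (m + 1))) ∧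
        ((Brick.nthF 1 v).length ≤ m ∨ elemOf Y m ∈ S) := by
  change (_ ∈ DigitOutOfRange ∨ _ ∈ DigitEq) ∧ boolPair v Y ∈ ballLang X (ballMatrix S) ↔ _
  rw [mem_DigitOutOfRange_iff, mem_DigitEq_iff, mem_ballLang]
  simp only [eval_X, length_boolPair, mem_ballMatrix_iff, List.length_replicate]

variable (S)

/-- "`j < i`" on tuples `v`. [folklore] -/
def JLt : Language Bool := pairFn (Brick.nthF 1) (Brick.nthF 2) ⁻¹' LenLt X

/-- `JLt ∈ P`. [folklore] -/
theorem JLt_mem_P : JLt ∈ Classes.P :=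
  preimage_mem_P (LenLt_mem_P X) (pairFn_mem_FP (Brick.nthF_mem_FP 1) (Brick.nthF_mem_FP 2))

/-- Membership in `JLt`. [folklore] -/
theorem mem_JLt_iff (v : List Bool) : v ∈ JLt ↔ (Brick.nthF 2 v).length < (Brick.nthF 1 v).length := by
  change pairFn (Brick.nthF 1) (Brick.nthF 2) v ∈ LenLt X ↔ _
  simp

/-- **The census language on unary tuples**, `padLang S = JLt ⊓ {v | ∃ Y, |Y| ≤ |v|² ∧ ⟨v, Y⟩ ∈ W}`:
the set `S'` of Hartmanis–Immerman–Sewelson read on unary tuples (its binary-named version is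
`decodeFn⁻¹(padLang S)`). [cite: HartmanisImmermanSewelson1985, Theorem 1 (proof, p. 163)] -/
def padLang : Language Bool :=
  JLt ⊓ {v | ∃ Y : List Bool, Y.length ≤ (X ^ 2 : Polynomial ℕ).eval v.length ∧ boolPair v Y ∈ witnessLang S}

variable {S}

/-- **`padLang S ∈ NP` for `S ∈ NP`** ("From these we see that `S' ∈ NEXPTIME`", p. 164 — here the
polynomial regime of the unary tuples; two existential blocks merge,
`KarpLipton.polyExists_polyExists_subset`). [cite: HartmanisImmermanSewelson1985, Theorem 1 (proof, p. 164)] -/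
theorem padLang_mem_NP (hS : S ∈ Nondeterministic.NP) : padLang S ∈ Nondeterministic.NP := by
  refine inter_P_mem_polyExists (fun _ _ h₁ h₂ => inter_mem_P h₁ h₂) JLt_mem_P ?_
  have h : {v | ∃ Y : List Bool, Y.length ≤ (X ^ 2 : Polynomial ℕ).eval v.length ∧
      boolPair v Y ∈ witnessLang S} ∈ polyExists Nondeterministic.NP :=
    ⟨witnessLang S, witnessLang_mem_NP hS, X ^ 2, fun _ => Iff.rfl⟩
  exact KarpLipton.polyExists_polyExists_subset (K := Classes.P) (fun _ hL _ hg => preimage_mem_P hL hg)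
    (fun _ _ h₁ h₂ => inter_mem_P h₁ h₂) h

/-- Access to a tabulated list. [folklore] -/
theorem getD_ofFn {i : ℕ} (f : Fin i → List Bool) {m : ℕ} (hm : m < i) :
    (List.ofFn f).getD m [] = f ⟨m, hm⟩ := by
  rw [List.getD_eq_getElem _ _ (by simpa using hm), List.getElem_ofFn]

/-- **The census language expresses the census predicate**:
`ucode n i j k d ∈ padLang S ↔ Cens S n i j k d`. (→): tabulate the words `elemOf Y m`, `m < i`,
read by the verifier off an accepted `Y`; (←): guess `Y = body ys` for a chain `ys`.
[cite: HartmanisImmermanSewelson1985, Theorem 1 (proof, pp. 163–164)] -/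
theorem ucode_mem_padLang_iff (n i j k : ℕ) (d : Bool) :
    ucode n i j k d ∈ padLang S ↔ Cens S n i j k d := by
  have hlen := length_ucode n i j k d
  change ucode n i j k d ∈ JLt ∧ (∃ Y : List Bool, Y.length ≤ (X ^ 2 : Polynomial ℕ).eval
    (ucode n i j k d).length ∧ boolPair (ucode n i j k d) Y ∈ witnessLang S) ↔ _
  rw [mem_JLt_iff]
  simp only [mem_witnessLang_iff, nthF_zero_ucode, nthF_one_ucode, nthF_two_ucode, nthF_three_ucode,
    sndPow_three_ucode, List.length_replicate, eval_pow, eval_X]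
  unfold Cens
  constructor
  · rintro ⟨hji, Y, -, hdig, hall⟩
    have hin : ∀ m, m < i → m < 2 * (ucode n i j k d).length + 2 + Y.length := fun m hm => by
      rw [hlen]; omega
    refine ⟨hji, List.ofFn fun m : Fin i => elemOf Y m, List.length_ofFn, ⟨?_, ?_, ?_⟩, ?_⟩
    · intro m hm
      rw [List.length_ofFn] at hm
      rw [getD_ofFn _ hm]
      exact ((hall m (hin m hm)).2.2).resolve_left (by omega)
    · intro m hm
      rw [List.length_ofFn] at hm
      rw [getD_ofFn _ hm]
      exact ((hall m (hin m hm)).1).resolve_left (by omega)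
    · intro m hm
      rw [List.length_ofFn] at hm
      rw [getD_ofFn _ (by omega), getD_ofFn _ hm]
      exact ((hall m (hin m (by omega))).2.1).resolve_left (by omega)
    · intro hk
      rw [getD_ofFn _ hji]
      exact getD_eq_of_take_drop (hdig.resolve_left (by omega))
  · rintro ⟨hji, ys, hys, hch, hdig⟩
    refine ⟨hji, body ys, ?_, ?_, ?_⟩
    · -- the guessed list is short
      have hb := length_body_le (cs := ys) (b := n) fun c hc => by
        obtain ⟨m, hm, rfl⟩ := List.getElem_of_mem hc
        have := hch.len m hm
        rw [List.getD_eq_getElem _ _ hm] at this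
        exact this.le
      rw [hys] at hb
      have h1 : i * (2 * n + 2) ≤ (ucode n i j k d).length ^ 2 := by rw [hlen]; nlinarith
      exact hb.trans h1
    · -- the digit
      rcases lt_or_ge k n with hk | hk
      · right
        have hl : k < (ys.getD j []).length := by rw [hch.len j (hys ▸ hji)]; exact hk
        rw [elemOf_body, List.take_one_drop_eq_of_lt_length hl]
        have := hdig hk
        rw [List.getD_eq_getElem _ _ hl] at this
        show [(ys.getD j [])[k]] = [d]
        rw [this]
      · exact Or.inl hk
    · intro m _
      refine ⟨?_, ?_, ?_⟩
      · rcases le_or_gt i m with him | him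
        · exact Or.inl him
        · right; rw [elemOf_body]; exact hch.len m (hys ▸ him)
      · rcases le_or_gt i (m + 1) with him | him
        · exact Or.inl him
        · right; rw [elemOf_body, elemOf_body]; exact hch.lt m (hys ▸ him)
      · rcases le_or_gt i m with him | him
        · exact Or.inl him
        · right; rw [elemOf_body]; exact hch.mem m (hys ▸ him)

end PadLang

end UpSep

end Literature.Computability.Complexity
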